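import Mathlib
import HarnessLib

/-!
# Weil-type family coverage — THEOREM S12 (b): the HYPERBOLIC REACH BOUND of the fibre-product / product-window method (kernel part)

research route conditional on HC_CM; not a corollary; Q11.4-sentence-2 already refuted in dim ≥ 3.

Ring 2, WEIL-TYPE FAMILY-COVERAGE CENSUS (`HOME/WEIL-FAMILY-COVERAGE.md` `## b04`, block b04.16 (A), owner ring2-b04, gen 52).  The census
populates components `(3, K, [a])` of polarised abelian sixfolds of Weil type by `λ`-isotypic new parts `B` of `G`-equivariant covers
`Y → D` of degree `N` (THEOREMS S7/S8: `[a_B] = [N]^{r(D)}·u^{m}`).  THEOREM S12 of the census shows that for a base `D/G ≅ ℙ¹` with `b`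
branch points of orders `o_P` the degree is bounded by the hyperbolic area of the base orbifold against the «savings» of the incompatible
fibre points: writing the fibre of `X = Y/G → ℙ¹` over the `P`-th branch point as a list of ramification indices `e` (positive, summing to
`N`), a point is COMPATIBLE when `o_P ∣ e` and saves nothing, INCOMPATIBLE otherwise and saves `1 - e/o_P < 1`; Riemann–Hurwitz gives
`Σ_P #fibre_P = (b-2)·N + 2 - 2·g_X + R` (`R ≥ 0` the extra ramification), and then

  `N · (b - 2 - Σ_P 1/o_P) ≤ S - 2 + 2·g_X - R`,   `S := Σ_P Σ_{e incompatible} (1 - e/o_P) ≤ #incompatible ≤ (budget)/κ_*`,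

the budget being the Chevalley–Weil identity S12 (a) `Σ_{incompatible} κ = m + r(D) + 2f - 2f·g_X`.  This file proves the COMBINATORIAL CORE
of S12 (b) for an arbitrary finite list of fibres — §1 the one-fibre inequality `#fibre ≤ N/o + S_P`, §2 its sum over the fibres, §3 the
Riemann–Hurwitz form `N·μ ≤ S - 2 + 2g - R`, §4 the budget form `N·μ ≤ C/κ_* - 2 + 2g - R` — as statements about lists of natural numbers
(no geometry is formalised: the two displayed hypotheses are exactly what Riemann–Hurwitz and Chevalley–Weil supply).  With `μ ≥ 1/42`
(Hurwitz) this is the finiteness of the reach of every carrier over every `K ∉ {ℚ(√-3), ℚ(i)}` (COROLLARY S12′ of the census); the exact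
reach sets (`GL₂(3)`: `N ≤ 81`, `PSL₂(7)`: `N ≤ 92`, `PSL₂(11)`: `N ≤ 16`, …) are the census's TABLE S12.

No `def`, no named fact, no `sorry`; nothing here is a statement about Hodge classes; `HC_CM` is used nowhere.
References: [cite: vanGeemen1994HodgeAV, (5.4.1)] for the component index only.
-/

set_option linter.dupNamespace false

namespace Summit.HodgeConjecture.HodgeConjecture.Ring2.WeilCoverage

/-! ### §1 One fibre: `#fibre ≤ N/o + Σ_{incompatible} (1 - e/o)` -/

/-- ONE FIBRE.  A fibre of a degree-`N` cover over a branch point of order `o ≥ 1` is a list `L` of positive ramification indices with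
`L.sum = N`; a point `e` with `o ∣ e` (compatible) has `e ≥ o`, i.e. counts at most `e/o`; an incompatible point counts `e/o + (1 - e/o)`.
Hence `L.length ≤ L.sum/o + Σ_{e ∈ L, o ∤ e} (1 - e/o)` — the termwise inequality behind THEOREM S12 (b).
research route conditional on HC_CM; not a corollary; Q11.4-sentence-2 already refuted in dim ≥ 3. -/
theorem fibre_length_le_sum_div_add_savings (o : ℕ) (ho : 0 < o) (L : List ℕ) (hpos : ∀ e ∈ L, 0 < e) :
    (L.length : ℚ) ≤ (L.sum : ℚ) / o + (L.map (fun e => if o ∣ e then (0 : ℚ) else 1 - (e : ℚ) / o)).sum := by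
  induction L with
  | nil => simp
  | cons a L ih =>
    have hL : ∀ e ∈ L, 0 < e := fun e he => hpos e (List.mem_cons_of_mem a he)
    have ha : 0 < a := hpos a (List.mem_cons_self)
    have ih' := ih hL
    have ho' : (0 : ℚ) < o := by exact_mod_cast ho
    simp only [List.length_cons, List.sum_cons, List.map_cons, Nat.cast_add, Nat.cast_succ]
    by_cases hd : o ∣ a
    · -- compatible point: `o ≤ a`, so `1 ≤ a/o`
      rw [if_pos hd]
      have hle : o ≤ a := Nat.le_of_dvd ha hd
      have hle' : (o : ℚ) ≤ a := by exact_mod_cast hle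
      have h1 : (1 : ℚ) ≤ (a : ℚ) / o := by
        rw [le_div_iff₀ ho']; simpa using hle'
      have : ((a : ℚ) + (L.sum : ℚ)) / o = (a : ℚ) / o + (L.sum : ℚ) / o := by ring
      rw [this]
      linarith
    · -- incompatible point: `1 = a/o + (1 - a/o)`
      rw [if_neg hd]
      have : ((a : ℚ) + (L.sum : ℚ)) / o = (a : ℚ) / o + (L.sum : ℚ) / o := by ring
      rw [this]
      linarith

/-- ONE FIBRE, counting form: the savings of a fibre are at most its number of incompatible points (each incompatible point saves
`1 - e/o < 1`, here only `≤ 1` is used).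
research route conditional on HC_CM; not a corollary; Q11.4-sentence-2 already refuted in dim ≥ 3. -/
theorem fibre_savings_le_incompatible_count (o : ℕ) (L : List ℕ) :
    (L.map (fun e => if o ∣ e then (0 : ℚ) else 1 - (e : ℚ) / o)).sum ≤
      (L.map (fun e => if o ∣ e then (0 : ℚ) else 1)).sum := by
  induction L with
  | nil => simp
  | cons a L ih =>
    simp only [List.map_cons, List.sum_cons]
    by_cases hd : o ∣ a
    · rw [if_pos hd, if_pos hd]; linarith
    · rw [if_neg hd, if_neg hd]
      have : (0 : ℚ) ≤ (a : ℚ) / o := by positivity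
      linarith

/-- ONE FIBRE, budget form: if every incompatible point costs at least `kstar > 0` (Chevalley–Weil: `κ(g_P^{e}) ≥ κ_*`), the number of
incompatible points is at most the fibre's total cost divided by `kstar`.
research route conditional on HC_CM; not a corollary; Q11.4-sentence-2 already refuted in dim ≥ 3. -/
theorem fibre_incompatible_count_le_cost_div (o kstar : ℕ) (hk : 0 < kstar) (cost : ℕ → ℕ)
    (hcost : ∀ e, ¬ o ∣ e → kstar ≤ cost e) (L : List ℕ) :
    (L.map (fun e => if o ∣ e then (0 : ℚ) else 1)).sum ≤
      (L.map (fun e => if o ∣ e then (0 : ℚ) else (cost e : ℚ))).sum / kstar := by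
  have hk' : (0 : ℚ) < kstar := by exact_mod_cast hk
  rw [le_div_iff₀ hk']
  induction L with
  | nil => simp
  | cons a L ih =>
    simp only [List.map_cons, List.sum_cons]
    by_cases hd : o ∣ a
    · rw [if_pos hd, if_pos hd]; linarith
    · rw [if_neg hd, if_neg hd]
      have h := hcost a hd
      have h' : (kstar : ℚ) ≤ cost a := by exact_mod_cast h
      nlinarith

/-! ### §2 All fibres: `Σ_P #fibre_P ≤ N·Σ_P 1/o_P + S` -/

/-- ALL FIBRES.  For a list of branch points, each given as a pair `(o_P, fibre_P)` with `o_P ≥ 1` and a fibre of positive ramification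
indices summing to the degree `N`: `Σ_P #fibre_P ≤ N · Σ_P 1/o_P + S`, `S = Σ_P Σ_{e incompatible} (1 - e/o_P)` — the sum of §1.
research route conditional on HC_CM; not a corollary; Q11.4-sentence-2 already refuted in dim ≥ 3. -/
theorem fibres_length_sum_le (N : ℕ) (F : List (ℕ × List ℕ))
    (ho : ∀ P ∈ F, 0 < P.1) (hpos : ∀ P ∈ F, ∀ e ∈ P.2, 0 < e) (hsum : ∀ P ∈ F, P.2.sum = N) :
    ((F.map (fun P => (P.2.length : ℚ))).sum) ≤
      (N : ℚ) * (F.map (fun P => (1 : ℚ) / P.1)).sum +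
        (F.map (fun P => (P.2.map (fun e => if P.1 ∣ e then (0 : ℚ) else 1 - (e : ℚ) / P.1)).sum)).sum := by
  induction F with
  | nil => simp
  | cons P F ih =>
    have ihF := ih (fun Q hQ => ho Q (List.mem_cons_of_mem P hQ)) (fun Q hQ => hpos Q (List.mem_cons_of_mem P hQ))
      (fun Q hQ => hsum Q (List.mem_cons_of_mem P hQ))
    have h1 := fibre_length_le_sum_div_add_savings P.1 (ho P List.mem_cons_self) P.2 (hpos P List.mem_cons_self)
    rw [hsum P List.mem_cons_self] at h1
    simp only [List.map_cons, List.sum_cons]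
    have : (N : ℚ) * ((1 : ℚ) / P.1 + (F.map (fun P => (1 : ℚ) / P.1)).sum) =
        (N : ℚ) / P.1 + (N : ℚ) * (F.map (fun P => (1 : ℚ) / P.1)).sum := by ring
    rw [this]
    linarith

/-! ### §3 THEOREM S12 (b): the hyperbolic reach bound `N·μ ≤ S - 2 + 2g - R` -/

/-- THEOREM S12 (b) (ring2-b04 census b04.16 (A)), combinatorial core.  Let the `b = F.length` fibres of a degree-`N` cover `X → ℙ¹` over
the branch points of the `G`-curve `D → ℙ¹` (orders `o_P`) satisfy Riemann–Hurwitz in the form `Σ_P #fibre_P = (b-2)·N + 2 - 2g + R` (`g` the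
genus of `X`, `R ≥ 0` the ramification of the cover away from the `b` points).  Then the degree obeys
`N · (b - 2 - Σ_P 1/o_P) ≤ S - 2 + 2g - R`: for a HYPERBOLIC base (`μ = b - 2 - Σ 1/o_P > 0`, `μ ≥ 1/42`) the degree is bounded by the savings
`S` of the incompatible points, which the Chevalley–Weil budget bounds in turn (§4).  For a EUCLIDEAN base (`μ = 0`) there is no bound —
the case `K ∈ {ℚ(√-3), ℚ(i)}` of THEOREMS S9/S10, where every degree occurs.
research route conditional on HC_CM; not a corollary; Q11.4-sentence-2 already refuted in dim ≥ 3. [cite: vanGeemen1994HodgeAV, (5.4.1)] -/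
theorem degree_mul_orbifold_char_le_savings (N g R : ℕ) (F : List (ℕ × List ℕ))
    (ho : ∀ P ∈ F, 0 < P.1) (hpos : ∀ P ∈ F, ∀ e ∈ P.2, 0 < e) (hsum : ∀ P ∈ F, P.2.sum = N)
    (hRH : ((F.map (fun P => (P.2.length : ℚ))).sum) = ((F.length : ℚ) - 2) * N + 2 - 2 * g + R) :
    (N : ℚ) * ((F.length : ℚ) - 2 - (F.map (fun P => (1 : ℚ) / P.1)).sum) ≤
      (F.map (fun P => (P.2.map (fun e => if P.1 ∣ e then (0 : ℚ) else 1 - (e : ℚ) / P.1)).sum)).sum - 2 + 2 * g - R := by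
  have h := fibres_length_sum_le N F ho hpos hsum
  rw [hRH] at h
  linarith

/-! ### §4 The budget form: `N·μ ≤ C/κ_* - 2 + 2g - R` -/

/-- ALL FIBRES, budget form of the savings: if every incompatible point over the `P`-th branch point costs `cost o_P e ≥ κ_* > 0`, then
`S ≤ (Σ_P Σ_{incompatible} cost)/κ_*`.
research route conditional on HC_CM; not a corollary; Q11.4-sentence-2 already refuted in dim ≥ 3. -/
theorem savings_sum_le_cost_sum_div (kstar : ℕ) (hk : 0 < kstar) (cost : ℕ → ℕ → ℕ) (F : List (ℕ × List ℕ))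
    (hcost : ∀ P ∈ F, ∀ e, ¬ P.1 ∣ e → kstar ≤ cost P.1 e) :
    (F.map (fun P => (P.2.map (fun e => if P.1 ∣ e then (0 : ℚ) else 1 - (e : ℚ) / P.1)).sum)).sum ≤
      (F.map (fun P => (P.2.map (fun e => if P.1 ∣ e then (0 : ℚ) else (cost P.1 e : ℚ))).sum)).sum / kstar := by
  induction F with
  | nil => simp
  | cons P F ih =>
    have ihF := ih (fun Q hQ => hcost Q (List.mem_cons_of_mem P hQ))
    simp only [List.map_cons, List.sum_cons]
    have h1 := fibre_savings_le_incompatible_count P.1 P.2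
    have h2 := fibre_incompatible_count_le_cost_div P.1 kstar hk (cost P.1) (hcost P List.mem_cons_self) P.2
    rw [add_div]
    linarith

/-- THEOREM S12 (b), budget form.  If moreover every incompatible point over the `P`-th branch point costs `cost o_P e ≥ κ_* > 0`
(Chevalley–Weil: the codimension of the fixed space of `g_P^{e}` on the carrier module) and the total cost of the incompatible points is `C`
(S12 (a): `C = m + r(D) + 2f - 2f·g`), then `N · (b - 2 - Σ_P 1/o_P) ≤ C/κ_* - 2 + 2g - R`.  With `b = 3`, `m = 6` and the carriers of record this
is `N < 216` (`GL₂(3)`), `462` (`PSL₂(7)`), `198` (`PSL₂(11)`) before the exact enumeration of the census (TABLE S12: 81 / 92 / 16).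
research route conditional on HC_CM; not a corollary; Q11.4-sentence-2 already refuted in dim ≥ 3. [cite: vanGeemen1994HodgeAV, (5.4.1)] -/
theorem degree_mul_orbifold_char_le_budget (N g R kstar : ℕ) (hk : 0 < kstar) (F : List (ℕ × List ℕ)) (cost : ℕ → ℕ → ℕ)
    (ho : ∀ P ∈ F, 0 < P.1) (hpos : ∀ P ∈ F, ∀ e ∈ P.2, 0 < e) (hsum : ∀ P ∈ F, P.2.sum = N)
    (hcost : ∀ P ∈ F, ∀ e, ¬ P.1 ∣ e → kstar ≤ cost P.1 e)
    (hRH : ((F.map (fun P => (P.2.length : ℚ))).sum) = ((F.length : ℚ) - 2) * N + 2 - 2 * g + R)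
    (C : ℚ) (hC : (F.map (fun P => (P.2.map (fun e => if P.1 ∣ e then (0 : ℚ) else (cost P.1 e : ℚ))).sum)).sum = C) :
    (N : ℚ) * ((F.length : ℚ) - 2 - (F.map (fun P => (1 : ℚ) / P.1)).sum) ≤ C / kstar - 2 + 2 * g - R := by
  have h := degree_mul_orbifold_char_le_savings N g R F ho hpos hsum hRH
  have hS := savings_sum_le_cost_sum_div kstar hk cost F hcost
  rw [hC] at hS
  linarith

/-! ### §5 The three-point form used by every window of record -/

/-- THREE BRANCH POINTS (the case of every rigid product / fibre-product window of the census: `GL₂(3)` `(2,3,8)`, `PSL₂(7)` `(2,3,7)`,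
`PSL₂(11)` `(2,3,11)`, …): with fibres `L₁, L₂, L₃` over branch points of orders `o₁, o₂, o₃` and `#L₁ + #L₂ + #L₃ = N + 2 - 2g + R`,
`N · (1 - 1/o₁ - 1/o₂ - 1/o₃) ≤ S₁ + S₂ + S₃ - 2 + 2g - R`.  For `(2,3,7)` the left factor is `1/42`, for `(2,3,8)` it is `1/24`, for `(2,3,11)`
`5/66`; for the Euclidean `(2,3,6), (2,4,4), (3,3,3)` it is `0` (THEOREMS S9/S10: every degree).
research route conditional on HC_CM; not a corollary; Q11.4-sentence-2 already refuted in dim ≥ 3. [cite: vanGeemen1994HodgeAV, (5.4.1)] -/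
theorem degree_bound_three_branch_points (N g R o₁ o₂ o₃ : ℕ) (h₁ : 0 < o₁) (h₂ : 0 < o₂) (h₃ : 0 < o₃) (L₁ L₂ L₃ : List ℕ)
    (p₁ : ∀ e ∈ L₁, 0 < e) (p₂ : ∀ e ∈ L₂, 0 < e) (p₃ : ∀ e ∈ L₃, 0 < e)
    (s₁ : L₁.sum = N) (s₂ : L₂.sum = N) (s₃ : L₃.sum = N)
    (hRH : (L₁.length : ℚ) + L₂.length + L₃.length = (N : ℚ) + 2 - 2 * g + R) :
    (N : ℚ) * (1 - 1 / (o₁ : ℚ) - 1 / (o₂ : ℚ) - 1 / (o₃ : ℚ)) ≤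
      (L₁.map (fun e => if o₁ ∣ e then (0 : ℚ) else 1 - (e : ℚ) / o₁)).sum +
      (L₂.map (fun e => if o₂ ∣ e then (0 : ℚ) else 1 - (e : ℚ) / o₂)).sum +
      (L₃.map (fun e => if o₃ ∣ e then (0 : ℚ) else 1 - (e : ℚ) / o₃)).sum - 2 + 2 * g - R := by
  have e₁ := fibre_length_le_sum_div_add_savings o₁ h₁ L₁ p₁
  have e₂ := fibre_length_le_sum_div_add_savings o₂ h₂ L₂ p₂
  have e₃ := fibre_length_le_sum_div_add_savings o₃ h₃ L₃ p₃
  rw [s₁] at e₁; rw [s₂] at e₂; rw [s₃] at e₃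
  have : (N : ℚ) * (1 - 1 / (o₁ : ℚ) - 1 / (o₂ : ℚ) - 1 / (o₃ : ℚ)) = N - N / o₁ - N / o₂ - N / o₃ := by ring
  rw [this]
  linarith

end Summit.HodgeConjecture.HodgeConjecture.Ring2.WeilCoverage
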